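import Mathlib
import Summits.NavierStokesRegularity.NavierStokesRegularity.Theorems.EulerZoomLiouvillePowerGaugeEulerLiouvilleSelfSimilarProfileEquationTools
import Summits.NavierStokesRegularity.NavierStokesRegularity.Theorems.EulerZoomLiouvillePowerGaugeEulerLiouvilleKillingRotation
import Summits.NavierStokesRegularity.NavierStokesRegularity.Theorems.EulerZoomLiouvillePowerGaugeEulerLiouvilleSpiralProfileGradient
import Literature.Analysis.FluidPDE.IsometryInvariance
import HarnessLib

/-!
# Crux `EulerZoomLiouville.PowerGaugeEulerLiouville` (stmt-NavierStokesRegularity-19832), width sub-line `relative_equilibria`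
# (ns-idea-11), R3a port recipe step P6, I: the SPIRAL (rotated, rescaled) space–time test field and its calculus

Route №10 `EulerZoomLiouville` (NavierStokesRegularity), crux E.  Seat ns-ezl-w2 g8 (`--supports stmt-19832 --as helper`).
The spiral (Perelman) ansatz of the line `relative_equilibria` is `u(t,x) = λ^{γ−1} Q_λ V(Q_λ⁻¹ λ^{−γ} x)`, `λ = −t`,
`Q_λ = e^{(log λ) S}` with `S` SKEW (`⟪Sx, y⟫ = −⟪x, Sy⟫`).  To transfer the distributional Euler identity of such a member to its
profile one tests with the ROTATED rescaled field `Ψ(t,x) = χ(t) Q_λ η(Q_λ⁻¹ λ^{−γ} x)` — the untwisted field of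
`ProfileEquation.isSpaceTimeTestOn_rescaled` (`…SelfSimilarProfileEquationTools`) turned with the profile.  This file is the spiral twin
of that tools file:

* `hasDerivAt_expSkew_log_apply` / `hasDerivAt_expSkew_negLog_apply` — `d/dt e^{±(log(−t))S} y = ± t⁻¹ S e^{±(log(−t))S} y`
  (group law / commutation / skewness from the tree: `Killing.*`, `CoriolisHead.TypeIRate.*`, `Spiral.inner_self_of_skew`);
* `isSpaceTimeTestOn_spiral` — `Ψ` is a space–time test field on the slab `(−∞,0) × ℝ³`;
* `fderiv_spiral_slice`, `divergence_spiral_slice`, `timeDeriv_spiral` — its slice derivative, divergence (rotation invariant) and time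
  derivative `∂ₜΨ = χ' Q η(z) + χ (−t)^{−1}(Q Dη(z)(S z + γ z) − S Q η(z))`, `z = Q⁻¹(−t)^{−γ}x` (the two `S`-terms are the new ones);
* `integral_slab_mul_comp_spiral` — Fubini for one rotated–dilated term on the slab: `∫∫ α(t) g(Q_t⁻¹(−t)^{−γ}x) = (∫α(−t)^{3γ})(∫g)`
  (rotations preserve Lebesgue measure, `Killing.integral_comp_expSkew`);
* `tested_integrand_spiral` — the pointwise form of the tested integrand of a spiral pair: the untwisted four terms plus
  `χ(−t)^{γ−2}(⟪V z, Dη(z)(S z)⟫ + ⟪S V z, η z⟫)`.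

The identity itself (`SpiralProfileEquation.weak_spiral_profile_equation`) is in part II.  WHAT THIS IS NOT: not NS, not E, no stub closed — calculus
for a brick of a width sub-line (the `O(3)`-twisted self-similar stratum); 19832 OPEN.  [folklore; ChaeTsai2013DSS p. 4 (Perelman's rotated ansatz)]
-/

noncomputable section

set_option linter.dupNamespace false

open MeasureTheory Set Filter Topology Metric Function TopologicalSpace
open scoped ENNReal NNReal RealInnerProductSpace ContDiff

namespace Summit.NavierStokesRegularity.NavierStokesRegularity.Theorems.PowerGaugeEulerLiouville

open Literature.Analysis Literature.Analysis.FunctionSpaces Literature.Analysis.FluidPDE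
open Summit.NavierStokesRegularity.NavierStokesRegularity.Theorems.CoriolisHead

namespace SpiralProfileEquation

variable {S : EuclideanSpace ℝ (Fin 3) →L[ℝ] EuclideanSpace ℝ (Fin 3)}

/-! ## The rotation clock `t ↦ e^{±(log(−t)) S}` on `t < 0` -/

section Clock

/-- `s ↦ e^{sS}` is smooth as a map into the operator algebra (the exponential of a Banach algebra is analytic). [folklore] -/
theorem contDiff_expSkew (S : EuclideanSpace ℝ (Fin 3) →L[ℝ] EuclideanSpace ℝ (Fin 3)) {n : ℕ∞} :
    ContDiff ℝ n (fun s : ℝ => NormedSpace.exp (s • S)) := by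
  have h1 : ContDiff ℝ n (fun s : ℝ => s • S) := contDiff_id.smul contDiff_const
  exact ContDiff.comp (contDiff_iff_contDiffAt.2 fun x => (NormedSpace.exp_analytic x).contDiffAt) h1

/-- `t ↦ e^{(log(−t))S}` is smooth at every `t < 0`. [folklore] -/
theorem contDiffAt_expSkew_log (S : EuclideanSpace ℝ (Fin 3) →L[ℝ] EuclideanSpace ℝ (Fin 3)) {t : ℝ} (ht : t < 0)
    {n : ℕ∞} : ContDiffAt ℝ n (fun s : ℝ => NormedSpace.exp ((Real.log (-s)) • S)) t := by
  have hlog : ContDiffAt ℝ n (fun s : ℝ => Real.log (-s)) t :=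
    (Real.contDiffAt_log.2 (neg_ne_zero.2 ht.ne)).comp t contDiffAt_id.neg
  exact (contDiff_expSkew S).contDiffAt.comp t hlog

/-- `t ↦ e^{−(log(−t))S}` is smooth at every `t < 0`. [folklore] -/
theorem contDiffAt_expSkew_negLog (S : EuclideanSpace ℝ (Fin 3) →L[ℝ] EuclideanSpace ℝ (Fin 3)) {t : ℝ} (ht : t < 0)
    {n : ℕ∞} : ContDiffAt ℝ n (fun s : ℝ => NormedSpace.exp ((-Real.log (-s)) • S)) t := by
  have hlog : ContDiffAt ℝ n (fun s : ℝ => -Real.log (-s)) t :=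
    ((Real.contDiffAt_log.2 (neg_ne_zero.2 ht.ne)).comp t contDiffAt_id.neg).neg
  exact (contDiff_expSkew S).contDiffAt.comp t hlog

/-- `d/dt log(−t) = t⁻¹` for `t < 0`. [folklore] -/
theorem hasDerivAt_log_neg {t : ℝ} (ht : t < 0) : HasDerivAt (fun s : ℝ => Real.log (-s)) t⁻¹ t := by
  have h := (Real.hasDerivAt_log (neg_ne_zero.2 ht.ne)).comp t (hasDerivAt_neg t)
  have e : (-t)⁻¹ * -1 = t⁻¹ := by rw [inv_neg]; ring
  rwa [e] at h

/-- **The clock turns at rate `t⁻¹ S`**: `d/dt e^{(log(−t))S} y = t⁻¹ • S (e^{(log(−t))S} y)` (`t < 0`). [folklore] -/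
theorem hasDerivAt_expSkew_log_apply (S : EuclideanSpace ℝ (Fin 3) →L[ℝ] EuclideanSpace ℝ (Fin 3))
    (y : EuclideanSpace ℝ (Fin 3)) {t : ℝ} (ht : t < 0) :
    HasDerivAt (fun s : ℝ => NormedSpace.exp ((Real.log (-s)) • S) y)
      (t⁻¹ • S (NormedSpace.exp ((Real.log (-t)) • S) y)) t := by
  have h := (TypeIRate.hasDerivAt_flow S y (Real.log (-t))).scomp t (hasDerivAt_log_neg ht)
  simpa only [Function.comp_def] using h

/-- `d/dt e^{−(log(−t))S} y = −t⁻¹ • S (e^{−(log(−t))S} y)` (`t < 0`). [folklore] -/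
theorem hasDerivAt_expSkew_negLog_apply (S : EuclideanSpace ℝ (Fin 3) →L[ℝ] EuclideanSpace ℝ (Fin 3))
    (y : EuclideanSpace ℝ (Fin 3)) {t : ℝ} (ht : t < 0) :
    HasDerivAt (fun s : ℝ => NormedSpace.exp ((-Real.log (-s)) • S) y)
      ((-t⁻¹) • S (NormedSpace.exp ((-Real.log (-t)) • S) y)) t := by
  have hl : HasDerivAt (fun s : ℝ => -Real.log (-s)) (-t⁻¹) t := (hasDerivAt_log_neg ht).neg
  have h := (TypeIRate.hasDerivAt_flow S y (-Real.log (-t))).scomp t hl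
  simpa only [Function.comp_def] using h

/-- `e^{sS}(e^{−sS} y) = y`. [folklore] -/
theorem expSkew_apply_expSkew_neg (S : EuclideanSpace ℝ (Fin 3) →L[ℝ] EuclideanSpace ℝ (Fin 3)) (s : ℝ)
    (y : EuclideanSpace ℝ (Fin 3)) : NormedSpace.exp (s • S) (NormedSpace.exp ((-s) • S) y) = y :=
  TypeIRate.flow_flow_neg S y s

/-- Rotations preserve inner products: `⟪e^{sS}x, e^{sS}y⟫ = ⟪x, y⟫` for skew `S`. [folklore] -/
theorem inner_expSkew_expSkew (hS : ∀ x y : EuclideanSpace ℝ (Fin 3), ⟪S x, y⟫ = -⟪x, S y⟫) (s : ℝ)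
    (x y : EuclideanSpace ℝ (Fin 3)) : ⟪NormedSpace.exp (s • S) x, NormedSpace.exp (s • S) y⟫ = ⟪x, y⟫ :=
  Killing.inner_expSkew_expSkew (Spiral.inner_self_of_skew hS) s x y

/-- Rotations preserve norms: `‖e^{sS}x‖ = ‖x‖` for skew `S`. [folklore] -/
theorem norm_expSkew (hS : ∀ x y : EuclideanSpace ℝ (Fin 3), ⟪S x, y⟫ = -⟪x, S y⟫) (s : ℝ)
    (x : EuclideanSpace ℝ (Fin 3)) : ‖NormedSpace.exp (s • S) x‖ = ‖x‖ :=
  TypeIRate.norm_exp_smul_skew (Spiral.inner_self_of_skew hS) s x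

end Clock

/-! ## The spiral space–time test fields -/

section TestField

variable {F : Type*} [NormedAddCommGroup F] [NormedSpace ℝ F]

/-- **The rotated–rescaled composite is a space–time test field** (no outer rotation; `F`-valued, e.g. a scalar test):
for `χ` smooth with `tsupport χ ⊆ (a,b)`, `b < 0`, `S` skew and a test function `θ` on `ℝ³`,
`(t,x) ↦ χ(t) θ(e^{−(log(−t))S}((−t)^{−γ}x))` is smooth with compact support inside the slab `(−∞,0) × ℝ³`
(the two-open-sets argument of `ProfileEquation.isSpaceTimeTestOn_rescaled`; rotations preserve norms). [folklore] -/
theorem isSpaceTimeTestOn_spiralComp {γ a b : ℝ} (hb : b < 0) {χ : ℝ → ℝ} (hχ : ContDiff ℝ (⊤ : ℕ∞) χ)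
    (hχI : tsupport χ ⊆ Ioo a b) (hS : ∀ x y : EuclideanSpace ℝ (Fin 3), ⟪S x, y⟫ = -⟪x, S y⟫)
    {θ : EuclideanSpace ℝ (Fin 3) → F} (hθ : IsTestFunctionOn (⊤ : Opens (EuclideanSpace ℝ (Fin 3))) θ) :
    IsSpaceTimeTestOn (slab (EuclideanSpace ℝ (Fin 3)) (Iio 0) isOpen_Iio)
      (fun t x => χ t • θ (NormedSpace.exp ((-Real.log (-t)) • S) ((-t) ^ (-γ) • x))) := by
  have hχ0 : ∀ t, b ≤ t → χ t = 0 := fun t ht =>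
    image_eq_zero_of_notMem_tsupport fun h => (not_lt.2 ht) (hχI h).2
  -- smoothness
  have hsmooth : ContDiff ℝ (⊤ : ℕ∞)
      (uncurry fun t x => χ t • θ (NormedSpace.exp ((-Real.log (-t)) • S) ((-t) ^ (-γ) • x))) := by
    rw [contDiff_iff_contDiffAt]
    rintro ⟨t, x⟩
    by_cases ht : t < 0
    · have h1 : ContDiffAt ℝ (⊤ : ℕ∞) (fun z : ℝ × EuclideanSpace ℝ (Fin 3) => χ z.1) (t, x) :=
        (hχ.contDiffAt).comp (t, x) contDiffAt_fst
      have h2 : ContDiffAt ℝ (⊤ : ℕ∞) (fun z : ℝ × EuclideanSpace ℝ (Fin 3) => (-z.1) ^ (-γ) • z.2) (t, x) :=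
        ((ProfileEquation.contDiffAt_neg_rpow ht (-γ)).comp (t, x) contDiffAt_fst).smul contDiffAt_snd
      have h3 := (contDiffAt_expSkew_negLog S ht (n := (⊤ : ℕ∞))).comp (t, x)
        (contDiffAt_fst (𝕜 := ℝ) (E := ℝ) (F := EuclideanSpace ℝ (Fin 3)) (p := (t, x)))
      have h4 := h3.clm_apply h2
      have h5 := hθ.contDiff.contDiffAt.comp (t, x) h4
      exact h1.smul h5
    · have hev : (uncurry fun t x => χ t • θ (NormedSpace.exp ((-Real.log (-t)) • S) ((-t) ^ (-γ) • x))) =ᶠ[𝓝 (t, x)]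
          fun _ => (0 : F) := by
        have hopen : IsOpen {z : ℝ × EuclideanSpace ℝ (Fin 3) | b < z.1} := isOpen_lt continuous_const continuous_fst
        have hmem : (t, x) ∈ {z : ℝ × EuclideanSpace ℝ (Fin 3) | b < z.1} := lt_of_lt_of_le hb (not_lt.1 ht)
        filter_upwards [hopen.mem_nhds hmem] with z hz
        simp only [uncurry, hχ0 z.1 (le_of_lt hz), zero_smul]
      exact (contDiffAt_const.congr_of_eventuallyEq hev)
  -- compact support
  obtain ⟨Rθ, hRθ⟩ := (hθ.hasCompactSupport.isCompact.isBounded).subset_closedBall (0 : EuclideanSpace ℝ (Fin 3))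
  set R' : ℝ := |Rθ| * ((-a) ^ γ + (-b) ^ γ) with hR'
  have hsupp : support (uncurry fun t x => χ t • θ (NormedSpace.exp ((-Real.log (-t)) • S) ((-t) ^ (-γ) • x))) ⊆
      Icc a b ×ˢ closedBall (0 : EuclideanSpace ℝ (Fin 3)) R' := by
    rintro ⟨t, x⟩ hz
    rw [mem_support] at hz
    simp only [uncurry] at hz
    have hχt : χ t ≠ 0 := fun h => hz (by rw [h, zero_smul])
    have hθx : θ (NormedSpace.exp ((-Real.log (-t)) • S) ((-t) ^ (-γ) • x)) ≠ 0 := fun h => hz (by rw [h, smul_zero])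
    have htI : t ∈ Ioo a b := hχI (subset_tsupport _ (mem_support.2 hχt))
    have ht0 : 0 < -t := by linarith [htI.2]
    have hy : ‖(-t) ^ (-γ) • x‖ ≤ Rθ := by
      have := hRθ (subset_tsupport _ (mem_support.2 hθx))
      rwa [mem_closedBall, dist_zero_right, norm_expSkew hS] at this
    refine ⟨Ioo_subset_Icc_self htI, ?_⟩
    rw [mem_closedBall, dist_zero_right]
    have hx : x = (-t) ^ γ • ((-t) ^ (-γ) • x) := (rpow_smul_rpow_neg_smul ht0 γ x).symm
    have hpow : (-t) ^ γ ≤ (-a) ^ γ + (-b) ^ γ := by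
      rcases le_total 0 γ with hγ | hγ
      · have h1 : (-t) ^ γ ≤ (-a) ^ γ :=
          Real.rpow_le_rpow ht0.le (by linarith [htI.1]) hγ
        linarith [Real.rpow_nonneg (show (0 : ℝ) ≤ -b by linarith) γ]
      · have h1 : (-t) ^ γ ≤ (-b) ^ γ :=
          Real.rpow_le_rpow_of_nonpos (by linarith) (by linarith [htI.2]) hγ
        linarith [Real.rpow_nonneg (show (0 : ℝ) ≤ -a by linarith [htI.1]) γ]
    calc ‖x‖ = ‖(-t) ^ γ • ((-t) ^ (-γ) • x)‖ := by rw [← hx]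
      _ = (-t) ^ γ * ‖(-t) ^ (-γ) • x‖ := by
          rw [norm_smul, Real.norm_of_nonneg (Real.rpow_nonneg ht0.le γ)]
      _ ≤ ((-a) ^ γ + (-b) ^ γ) * |Rθ| :=
          mul_le_mul hpow (hy.trans (le_abs_self _)) (norm_nonneg _)
            (add_nonneg (Real.rpow_nonneg (by linarith [htI.1]) γ) (Real.rpow_nonneg (by linarith [htI.2]) γ))
      _ = R' := by rw [hR']; ring
  have hK : IsCompact (Icc a b ×ˢ closedBall (0 : EuclideanSpace ℝ (Fin 3)) R') :=
    isCompact_Icc.prod (isCompact_closedBall _ _)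
  refine ⟨hsmooth, HasCompactSupport.of_support_subset_isCompact hK hsupp, ?_⟩
  intro z hz
  have hz' : z ∈ Icc a b ×ˢ closedBall (0 : EuclideanSpace ℝ (Fin 3)) R' :=
    closure_minimal hsupp (hK.isClosed) hz
  rw [coe_slab]
  exact ⟨lt_of_le_of_lt hz'.1.2 hb, mem_univ _⟩

/-- **The SPIRAL test field is a space–time test field on the slab**: for `χ` smooth with `tsupport χ ⊆ (a,b)`, `b < 0`, `S` skew and a
vector test field `η`, `Ψ(t,x) = χ(t) e^{(log(−t))S} η(e^{−(log(−t))S}((−t)^{−γ}x))` is smooth with compact support inside `(−∞,0) × ℝ³`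
(the outer rotation is a smooth operator-valued factor and does not move the support). [folklore] -/
theorem isSpaceTimeTestOn_spiral {γ a b : ℝ} (hb : b < 0) {χ : ℝ → ℝ} (hχ : ContDiff ℝ (⊤ : ℕ∞) χ)
    (hχI : tsupport χ ⊆ Ioo a b) (hS : ∀ x y : EuclideanSpace ℝ (Fin 3), ⟪S x, y⟫ = -⟪x, S y⟫)
    {η : EuclideanSpace ℝ (Fin 3) → EuclideanSpace ℝ (Fin 3)}
    (hη : IsTestFunctionOn (⊤ : Opens (EuclideanSpace ℝ (Fin 3))) η) :
    IsSpaceTimeTestOn (slab (EuclideanSpace ℝ (Fin 3)) (Iio 0) isOpen_Iio)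
      (fun t x => χ t • NormedSpace.exp ((Real.log (-t)) • S)
        (η (NormedSpace.exp ((-Real.log (-t)) • S) ((-t) ^ (-γ) • x)))) := by
  obtain ⟨hsm, hcs, hsub⟩ := isSpaceTimeTestOn_spiralComp (γ := γ) hb hχ hχI hS hη
  have hχ0 : ∀ t, b ≤ t → χ t = 0 := fun t ht =>
    image_eq_zero_of_notMem_tsupport fun h => (not_lt.2 ht) (hχI h).2
  -- the outer rotation, written through the inner composite
  have heq : (uncurry fun t x => χ t • NormedSpace.exp ((Real.log (-t)) • S)
        (η (NormedSpace.exp ((-Real.log (-t)) • S) ((-t) ^ (-γ) • x)))) =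
      fun z : ℝ × EuclideanSpace ℝ (Fin 3) => NormedSpace.exp ((Real.log (-z.1)) • S)
        ((uncurry fun t x => χ t • η (NormedSpace.exp ((-Real.log (-t)) • S) ((-t) ^ (-γ) • x))) z) := by
    funext z
    simp only [uncurry, map_smul]
  -- smoothness
  have hsmooth : ContDiff ℝ (⊤ : ℕ∞) (uncurry fun t x => χ t • NormedSpace.exp ((Real.log (-t)) • S)
      (η (NormedSpace.exp ((-Real.log (-t)) • S) ((-t) ^ (-γ) • x)))) := by
    rw [heq, contDiff_iff_contDiffAt]
    rintro ⟨t, x⟩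
    by_cases ht : t < 0
    · have h3 := (contDiffAt_expSkew_log S ht (n := (⊤ : ℕ∞))).comp (t, x)
        (contDiffAt_fst (𝕜 := ℝ) (E := ℝ) (F := EuclideanSpace ℝ (Fin 3)) (p := (t, x)))
      exact h3.clm_apply hsm.contDiffAt
    · have hev : (fun z : ℝ × EuclideanSpace ℝ (Fin 3) => NormedSpace.exp ((Real.log (-z.1)) • S)
          ((uncurry fun t x => χ t • η (NormedSpace.exp ((-Real.log (-t)) • S) ((-t) ^ (-γ) • x))) z)) =ᶠ[𝓝 (t, x)]
          fun _ => (0 : EuclideanSpace ℝ (Fin 3)) := by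
        have hopen : IsOpen {z : ℝ × EuclideanSpace ℝ (Fin 3) | b < z.1} := isOpen_lt continuous_const continuous_fst
        have hmem : (t, x) ∈ {z : ℝ × EuclideanSpace ℝ (Fin 3) | b < z.1} := lt_of_lt_of_le hb (not_lt.1 ht)
        filter_upwards [hopen.mem_nhds hmem] with z hz
        simp only [uncurry, hχ0 z.1 (le_of_lt hz), zero_smul, map_zero]
      exact (contDiffAt_const.congr_of_eventuallyEq hev)
  -- support: the rotation does not move it
  have hsupp : support (uncurry fun t x => χ t • NormedSpace.exp ((Real.log (-t)) • S)
      (η (NormedSpace.exp ((-Real.log (-t)) • S) ((-t) ^ (-γ) • x)))) =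
      support (uncurry fun t x => χ t • η (NormedSpace.exp ((-Real.log (-t)) • S) ((-t) ^ (-γ) • x))) := by
    ext z
    rw [heq, mem_support, mem_support, not_iff_not]
    constructor
    · intro h
      have h2 := congrArg (fun w => NormedSpace.exp ((-Real.log (-z.1)) • S) w) h
      simpa only [Killing.expSkew_neg_apply_expSkew, map_zero] using h2
    · intro h
      rw [h, map_zero]
  refine ⟨hsmooth, ?_, ?_⟩
  · show HasCompactSupport _
    rw [HasCompactSupport, tsupport, hsupp]
    exact hcs
  · show tsupport _ ⊆ _
    rw [tsupport, hsupp]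
    exact hsub

end TestField

/-! ## Slice derivative, divergence and time derivative of the spiral test field -/

section Calculus

variable {F : Type*} [NormedAddCommGroup F] [NormedSpace ℝ F]

/-- Spatial derivative of the spiral field on a slice: with `Q = e^{(log(−t))S}`, `Q⁻¹ = e^{−(log(−t))S}`, `z = Q⁻¹((−t)^{−γ}x)`,
`D_x Ψ(t,·)(x) v = χ(t) Q (Dη(z) (Q⁻¹((−t)^{−γ} v)))`. [folklore] -/
theorem fderiv_spiral_slice {γ : ℝ} (χ : ℝ → ℝ) {η : EuclideanSpace ℝ (Fin 3) → EuclideanSpace ℝ (Fin 3)}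
    (hη : Differentiable ℝ η) (t : ℝ) (x v : EuclideanSpace ℝ (Fin 3)) :
    fderiv ℝ (fun x => χ t • NormedSpace.exp ((Real.log (-t)) • S)
        (η (NormedSpace.exp ((-Real.log (-t)) • S) ((-t) ^ (-γ) • x)))) x v =
      χ t • NormedSpace.exp ((Real.log (-t)) • S)
        (fderiv ℝ η (NormedSpace.exp ((-Real.log (-t)) • S) ((-t) ^ (-γ) • x))
          (NormedSpace.exp ((-Real.log (-t)) • S) ((-t) ^ (-γ) • v))) := by
  set Q : EuclideanSpace ℝ (Fin 3) →L[ℝ] EuclideanSpace ℝ (Fin 3) := NormedSpace.exp ((Real.log (-t)) • S) with hQ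
  set Qi : EuclideanSpace ℝ (Fin 3) →L[ℝ] EuclideanSpace ℝ (Fin 3) := NormedSpace.exp ((-Real.log (-t)) • S) with hQi
  have h0 : HasFDerivAt (fun x : EuclideanSpace ℝ (Fin 3) => (-t) ^ (-γ) • x)
      ((-t) ^ (-γ) • ContinuousLinearMap.id ℝ (EuclideanSpace ℝ (Fin 3))) x :=
    (hasFDerivAt_id x).const_smul ((-t) ^ (-γ))
  have h1 : HasFDerivAt (fun x : EuclideanSpace ℝ (Fin 3) => Qi ((-t) ^ (-γ) • x))
      (Qi.comp ((-t) ^ (-γ) • ContinuousLinearMap.id ℝ (EuclideanSpace ℝ (Fin 3)))) x :=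
    Qi.hasFDerivAt.comp x h0
  have h2 : HasFDerivAt (fun x : EuclideanSpace ℝ (Fin 3) => η (Qi ((-t) ^ (-γ) • x)))
      ((fderiv ℝ η (Qi ((-t) ^ (-γ) • x))).comp
        (Qi.comp ((-t) ^ (-γ) • ContinuousLinearMap.id ℝ (EuclideanSpace ℝ (Fin 3))))) x :=
    (hη _).hasFDerivAt.comp x h1
  have h3 : HasFDerivAt (fun x : EuclideanSpace ℝ (Fin 3) => χ t • Q (η (Qi ((-t) ^ (-γ) • x))))
      (χ t • (Q.comp ((fderiv ℝ η (Qi ((-t) ^ (-γ) • x))).comp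
        (Qi.comp ((-t) ^ (-γ) • ContinuousLinearMap.id ℝ (EuclideanSpace ℝ (Fin 3))))))) x :=
    (Q.hasFDerivAt.comp x h2).const_smul (χ t)
  rw [h3.fderiv]
  simp [map_smul]

/-- Divergence of the spiral field on a slice: `div_x Ψ(t,·)(x) = χ(t) (−t)^{−γ} div η(z)`, `z = e^{−(log(−t))S}((−t)^{−γ}x)` — the
conjugation by the rotation does not change the trace (`divergence_conj_linearIsometryEquiv`). [folklore] -/
theorem divergence_spiral_slice {γ : ℝ} (χ : ℝ → ℝ) (hS : ∀ x y : EuclideanSpace ℝ (Fin 3), ⟪S x, y⟫ = -⟪x, S y⟫)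
    {η : EuclideanSpace ℝ (Fin 3) → EuclideanSpace ℝ (Fin 3)} (hη : Differentiable ℝ η) (t : ℝ)
    (x : EuclideanSpace ℝ (Fin 3)) :
    VectorCalculus.divergence (fun x => χ t • NormedSpace.exp ((Real.log (-t)) • S)
        (η (NormedSpace.exp ((-Real.log (-t)) • S) ((-t) ^ (-γ) • x)))) x =
      χ t * ((-t) ^ (-γ) * VectorCalculus.divergence η (NormedSpace.exp ((-Real.log (-t)) • S) ((-t) ^ (-γ) • x))) := by
  -- the rotation as a linear isometry equivalence `R = Q`, `R⁻¹ = Q⁻¹`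
  obtain ⟨R, hR, hRs⟩ := rss_exists_rot (Spiral.inner_self_of_skew hS) (-Real.log (-t))
  have hR' : ∀ y, R y = NormedSpace.exp ((Real.log (-t)) • S) y := fun y => by rw [hR, neg_neg]
  have heq : (fun x => χ t • NormedSpace.exp ((Real.log (-t)) • S)
        (η (NormedSpace.exp ((-Real.log (-t)) • S) ((-t) ^ (-γ) • x)))) =
      fun x => R ((fun w => χ t • η ((-t) ^ (-γ) • w)) (R.symm x)) := by
    funext x
    simp only [hR', hRs, map_smul]
  rw [heq, divergence_conj_linearIsometryEquiv R (fun w => χ t • η ((-t) ^ (-γ) • w)) x,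
    ProfileEquation.divergence_rescaled_slice χ hη t (R.symm x), hRs, map_smul]

/-- **Time derivative of the spiral test field** at `t < 0`: with `Q = e^{(log(−t))S}`, `z = Q⁻¹((−t)^{−γ}x)`,
`∂ₜΨ(t,x) = χ'(t) Q η(z) + χ(t) (−t)^{−1} (Q Dη(z)(S z + γ z) − S Q η(z))` — the clock turns at rate `t⁻¹ S` and `z` moves by
`ż = (−t)^{−1}(S z + γ z)`; the two `S`-terms are the spiral corrections to `ProfileEquation.timeDeriv_rescaled`. [folklore] -/
theorem timeDeriv_spiral {γ : ℝ} {χ : ℝ → ℝ} (hχ : Differentiable ℝ χ)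
    {η : EuclideanSpace ℝ (Fin 3) → EuclideanSpace ℝ (Fin 3)} (hη : Differentiable ℝ η) {t : ℝ} (ht : t < 0)
    (x : EuclideanSpace ℝ (Fin 3)) :
    timeDeriv (fun t x => χ t • NormedSpace.exp ((Real.log (-t)) • S)
        (η (NormedSpace.exp ((-Real.log (-t)) • S) ((-t) ^ (-γ) • x)))) t x =
      deriv χ t • NormedSpace.exp ((Real.log (-t)) • S) (η (NormedSpace.exp ((-Real.log (-t)) • S) ((-t) ^ (-γ) • x))) +
        χ t • ((-t) ^ (-1 : ℝ) •
          (NormedSpace.exp ((Real.log (-t)) • S)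
              (fderiv ℝ η (NormedSpace.exp ((-Real.log (-t)) • S) ((-t) ^ (-γ) • x))
                (S (NormedSpace.exp ((-Real.log (-t)) • S) ((-t) ^ (-γ) • x)) +
                  γ • NormedSpace.exp ((-Real.log (-t)) • S) ((-t) ^ (-γ) • x))) -
            S (NormedSpace.exp ((Real.log (-t)) • S) (η (NormedSpace.exp ((-Real.log (-t)) • S) ((-t) ^ (-γ) • x)))))) := by
  rw [timeDeriv_apply]
  have ht0 : 0 < -t := neg_pos.2 ht
  have hinv : (-t) ^ (-1 : ℝ) = -t⁻¹ := by rw [Real.rpow_neg_one, inv_neg]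
  set z : EuclideanSpace ℝ (Fin 3) := NormedSpace.exp ((-Real.log (-t)) • S) ((-t) ^ (-γ) • x) with hz
  -- the inner curve `s ↦ Q⁻¹(s)((−s)^{−γ} x)` and its velocity `(−t)^{−1}(S z + γ z)`
  have hpow : HasDerivAt (fun s : ℝ => (-s) ^ (-γ)) (-(-γ) * (-t) ^ (-γ - 1)) t := by
    have h1 : HasDerivAt (fun s : ℝ => -s) (-1) t := hasDerivAt_neg t
    have h2 := h1.rpow_const (p := -γ) (Or.inl ht0.ne')
    convert h2 using 1
    ring
  have hw : HasDerivAt (fun s : ℝ => (-s) ^ (-γ) • x) ((-(-γ) * (-t) ^ (-γ - 1)) • x) t := hpow.smul_const x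
  have hQi : HasDerivAt (fun s : ℝ => NormedSpace.exp ((-Real.log (-s)) • S))
      ((-t⁻¹) • (S * NormedSpace.exp ((-Real.log (-t)) • S))) t := by
    have hl : HasDerivAt (fun s : ℝ => -Real.log (-s)) (-t⁻¹) t := (hasDerivAt_log_neg ht).neg
    have h := (hasDerivAt_exp_smul_const' (𝕂 := ℝ) S (-Real.log (-t))).scomp t hl
    simpa only [Function.comp_def] using h
  have hzd : HasDerivAt (fun s : ℝ => NormedSpace.exp ((-Real.log (-s)) • S) ((-s) ^ (-γ) • x))
      (((-t⁻¹) • (S * NormedSpace.exp ((-Real.log (-t)) • S))) ((-t) ^ (-γ) • x) +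
        NormedSpace.exp ((-Real.log (-t)) • S) ((-(-γ) * (-t) ^ (-γ - 1)) • x)) t :=
    hQi.clm_apply hw
  -- `η ∘ z`
  have hηz : HasDerivAt (fun s : ℝ => η (NormedSpace.exp ((-Real.log (-s)) • S) ((-s) ^ (-γ) • x)))
      (fderiv ℝ η z (((-t⁻¹) • (S * NormedSpace.exp ((-Real.log (-t)) • S))) ((-t) ^ (-γ) • x) +
        NormedSpace.exp ((-Real.log (-t)) • S) ((-(-γ) * (-t) ^ (-γ - 1)) • x))) t :=
    (hη z).hasFDerivAt.comp_hasDerivAt t hzd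
  -- the outer clock `Q(s)` applied to `η(z(s))`
  have hQ : HasDerivAt (fun s : ℝ => NormedSpace.exp ((Real.log (-s)) • S))
      (t⁻¹ • (S * NormedSpace.exp ((Real.log (-t)) • S))) t := by
    have h := (hasDerivAt_exp_smul_const' (𝕂 := ℝ) S (Real.log (-t))).scomp t (hasDerivAt_log_neg ht)
    simpa only [Function.comp_def] using h
  have hQη := hQ.clm_apply hηz
  have h : HasDerivAt (fun s : ℝ => χ s • NormedSpace.exp ((Real.log (-s)) • S)
      (η (NormedSpace.exp ((-Real.log (-s)) • S) ((-s) ^ (-γ) • x)))) _ t := (hχ t).hasDerivAt.smul hQη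
  rw [h.deriv]
  -- algebra
  have e : (-(-γ) * (-t) ^ (-γ - 1)) • x = (γ * (-t) ^ (-1 : ℝ)) • ((-t) ^ (-γ) • x) := by
    rw [smul_smul, show -γ - 1 = (-1 : ℝ) + -γ by ring, Real.rpow_add ht0]
    ring_nf
  rw [e]
  simp only [smul_apply, mul_apply_eq_comp]
  simp only [← hz]
  have hA : NormedSpace.exp ((-Real.log (-t)) • S) ((γ * (-t) ^ (-1 : ℝ)) • ((-t) ^ (-γ) • x)) =
      (γ * (-t) ^ (-1 : ℝ)) • z := by
    rw [hz]; exact map_smul _ _ _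
  rw [hA]
  simp only [map_add, map_smul, map_neg, smul_add, smul_sub, hinv, neg_smul, smul_neg]
  module

end Calculus

end SpiralProfileEquation

end Summit.NavierStokesRegularity.NavierStokesRegularity.Theorems.PowerGaugeEulerLiouville

end
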